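import Summits.KontsevichZagierPeriods.KontsevichZagierPeriods.Theses.UnfoldedStokes
import Summits.KontsevichZagierPeriods.KontsevichZagierPeriods.Theorems.GpcLegendreLemniscatic.Negative.LoadBearing
import Summits.KontsevichZagierPeriods.KontsevichZagierPeriods.Theorems.UnfoldedStokesLegendreCubicFormStubInjOn
import Summits.KontsevichZagierPeriods.KontsevichZagierPeriods.Theorems.UnfoldedStokesLegendreCubicFormStubImage
import Summits.KontsevichZagierPeriods.KontsevichZagierPeriods.Theorems.UnfoldedStokesLegendreCubicFormStubJacobian
import Summits.KontsevichZagierPeriods.KontsevichZagierPeriods.Theorems.UnfoldedStokesLegendreCubicFormStubTransfer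
import Summits.KontsevichZagierPeriods.KontsevichZagierPeriods.Theorems.UnfoldedStokesLegendreCubicFormStubHeightNL
import Summits.KontsevichZagierPeriods.KontsevichZagierPeriods.Theorems.UnfoldedStokesLegendreCubicFormStubArctanTail

/-!
# Disproof of `LegendreCubicForm` (stmt-KontsevichZagierPeriods-3521) — findings

cdisprove seat `refuter-cdisprove-stmt-KontsevichZagierPeriods-3521-0`, cycle 1 (2026-08-16).
Crux (route UnfoldedStokes, rank 3): for rational `e₁ < e₂ < e₃`, `P = (x−e₁)(x−e₂)(x−e₃)`,
`[(e₁,e₂)×(e₂,e₃), (x₁−x₀)/√(|P(x₀)||P(x₁)|)] ~ [ℝ, 2/(1+x²)]` in the Kontsevich–Zagier calculus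
(Legendre's relation `η₂ω₁ − η₁ω₂ = 2πi` in single-curve interval form).

**STATUS: NO KILL POSSIBLE — the crux is TRUE.** The line lead's six stubs of line `Sketch`
(hat-box chart) are LANDED tree theorems (p96450 `stub_hatBoxInjOn`, p96680 `stub_hatBoxImage`,
p96835 `stub_hatBoxJacobian`, p96723 `stub_hatBoxTransfer`, p96523 `stub_heightNewtonLeibniz`,
p96515 `stub_arctanTail`; namespace `Summit.KontsevichZagierPeriods.UnfoldedStokes.LegendreCubicFormLine`)
and compose to the crux BY NAME (pure logic; re-checked in this seat's `W.lean` and used in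
`cubicRep_value` below). The value identity was re-checked numerically to ≤ 6.4e−14 on 13 root
triples (num/cubic_check.py, incl. near-nodal `(0, 1/1000, 1)` and stretched `(0, 1, 100)`), and is
now a THEOREM (`legendre_relation`).

What this file records (negative knowledge for the sibling cruxes 3522 / 3523 / 0280 / 3013 and for
planners who copy the statement's shape; everything is `sorry`-free):

* §1 vocabulary: `box`, `cubicIntegrand`, the target `twoArctanRep = [ℝ, 2/(1+x²)]` (value `2π`),
  `legendreCubicForm_iff_pinned` (the defs are the crux's binders verbatim, `Iff.rfl`).
* §2 ONE-DIMENSIONAL ANALYSIS (stub-free): the inverse-square-root endpoint test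
  `integrableOn_Ioo_of_inv_sqrt_bound`; `1/√|P|` is integrable on both gaps
  (`integrableOn_inv_sqrt_abs_cubic_gap1/2`, two-sided singularities, explicit domination); the
  four half-period representations `k1Rep, xk1Rep, k2Rep, xk2Rep` (values `I₁⁰, I₁¹, I₂⁰, I₂¹`,
  `halfPeriod`).
* §3 NON-VACUITY (stub-free): the crux's left representation EXISTS, `cubicRep = [R, g]`,
  integrable as the difference of two Fubini products `[k₁]·[t k₂] − [t k₁]·[k₂]`; the literal form
  `cubicRep_value_eq_halfPeriods : value = I₁⁰I₂¹ − I₁¹I₂⁰`; `legendreCubicForm_iff_canonical`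
  (the `∀ r r'` shape and off-domain values are harmless).
* §4 VALUE (from the landed stubs + soundness): `cubicRep_value = 2π`, whence the classical
  **Legendre relation for every rational cubic**, `legendre_relation : I₁⁰I₂¹ − I₁¹I₂⁰ = 2π`,
  kernel-checked — no evaluation invariant separates the pair.
* §5 LOAD-BEARING hypotheses: each of the six hypotheses (`e₁ < e₂`, `e₂ < e₃`, the four pinning
  hypotheses) is necessary (`legendreCubicForm_false_without_*`).
* §6 NEWTON–LEIBNIZ IS NECESSARY (`not_mem_closure_without_newtonLeibniz`, invariant
  `eval ∘ dimProj 2` of the 0280 seat): every derivation uses rule (3), whatever `r'` is.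
* §7 TIGHTNESS — refuted natural mis-statements: `not_negOrientation` (numerator `x₀ − x₁`:
  value `−2π`), `not_swappedBox` (imaginary gap first: `−2π`), `not_sameGap` (the SAME gap twice:
  value `I₁⁰I₁¹ − I₁¹I₁⁰ = 0`), `not_halfPiTarget` (right-hand side `[ℝ, 1/(2(1+x²))]` = `π/2` of
  3523 / 0280: the single-curve constant is `2π = 4 · π/2`).
* §8 (docstring) hypothesis weakenings that do NOT break it, and why no substantive kill exists.
-/

noncomputable section

open MeasureTheory Set
open Literature.NumberTheory.Transcendental
open Literature.NumberTheory.Transcendental.KZ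
open Literature.ModelTheory.ExponentialFields (IsSemialgebraic isSemialgebraic_setOf_eval_pos)
open MvPolynomial (aeval X C)
open Summit.KontsevichZagierPeriods.KontsevichZagierPeriods.Theses.UnfoldedStokes (LegendreCubicForm)
open Summit.KontsevichZagierPeriods.Grothendieck.GpcLegendreLemniscaticNegative
  (emptyRep emptyRep_value zeroRep zeroRep_value arctanRep arctanRep_value arctanRep_domain
    arctanRep_integrand equivalent_of_eqOn dimProj dimProj_of closure_sameDim_le_ker)
open Summit.KontsevichZagierPeriods.UnfoldedStokes.LegendreCubicFormLine

-- `Summit.<Summit>.<Sub>` with Sub = Summit (single-conjunct summit, D-0017) duplicates the segment.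
set_option linter.dupNamespace false

namespace Summit.KontsevichZagierPeriods.KontsevichZagierPeriods.Cruxes.LegendreCubicForm.Disproof

/-! ## §1 Vocabulary -/

/-- The open period rectangle `R = (e₁,e₂) × (e₂,e₃)` (the crux's `r.domain`, verbatim). [folklore] -/
def box (e₁ e₂ e₃ : ℚ) : Set (Fin 2 → ℝ) :=
  {x | (e₁ : ℝ) < x 0 ∧ x 0 < (e₂ : ℝ) ∧ (e₂ : ℝ) < x 1 ∧ x 1 < (e₃ : ℝ)}

/-- The crux integrand `g(x) = (x₁ − x₀)/√(|P(x₀)|·|P(x₁)|)`, `P = (x−e₁)(x−e₂)(x−e₃)` (verbatim). [folklore] -/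
def cubicIntegrand (e₁ e₂ e₃ : ℚ) (x : Fin 2 → ℝ) : ℝ :=
  (x 1 - x 0) / Real.sqrt (|(x 0 - (e₁ : ℝ)) * (x 0 - (e₂ : ℝ)) * (x 0 - (e₃ : ℝ))| *
    |(x 1 - (e₁ : ℝ)) * (x 1 - (e₂ : ℝ)) * (x 1 - (e₃ : ℝ))|)

/-- READBACK: the crux is the pinned `∀ r r'` statement over `box` / `cubicIntegrand` /
`[ℝ, 2/(1+x²)]` (definitional, `Iff.rfl`). [folklore] -/
theorem legendreCubicForm_iff_pinned : LegendreCubicForm ↔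
    ∀ (e₁ e₂ e₃ : ℚ), e₁ < e₂ → e₂ < e₃ → ∀ (r : IntegralRep 2) (r' : IntegralRep 1),
      r.domain = box e₁ e₂ e₃ → EqOn r.integrand (cubicIntegrand e₁ e₂ e₃) r.domain →
      r'.domain = univ → EqOn r'.integrand (fun x => 2 / (1 + x 0 ^ 2)) r'.domain → Equivalent r r' :=
  Iff.rfl

/-- The rectangle is `ℚ`-semialgebraic (four polynomial sign conditions). [folklore] -/
theorem isSemialgebraic_box (e₁ e₂ e₃ : ℚ) : IsSemialgebraic ℚ (box e₁ e₂ e₃) := by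
  have h1 := isSemialgebraic_setOf_eval_pos (k := ℚ) (R := ℝ) (X 0 - C e₁ : MvPolynomial (Fin 2) ℚ)
  have h2 := isSemialgebraic_setOf_eval_pos (k := ℚ) (R := ℝ) (C e₂ - X 0 : MvPolynomial (Fin 2) ℚ)
  have h3 := isSemialgebraic_setOf_eval_pos (k := ℚ) (R := ℝ) (X 1 - C e₂ : MvPolynomial (Fin 2) ℚ)
  have h4 := isSemialgebraic_setOf_eval_pos (k := ℚ) (R := ℝ) (C e₃ - X 1 : MvPolynomial (Fin 2) ℚ)
  simp only [map_sub, MvPolynomial.aeval_X, MvPolynomial.aeval_C, eq_ratCast, sub_pos] at h1 h2 h3 h4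
  convert h1.inter (h2.inter (h3.inter h4)) using 1
  ext x
  simp only [box, mem_setOf_eq, mem_inter_iff]

/-- **The target representation** `[ℝ, 2/(1+x²)]` (value `2π`). [folklore] -/
def twoArctanRep : IntegralRep 1 where
  domain := univ
  integrand := fun x => 2 / (1 + x 0 ^ 2)
  isSemialgebraic_domain := Literature.ModelTheory.ExponentialFields.isSemialgebraic_univ
  isSemialgebraicFunOn_integrand := by
    have hu : IsSemialgebraic ℚ (univ : Set (Fin 1 → ℝ)) :=
      Literature.ModelTheory.ExponentialFields.isSemialgebraic_univ
    have h := isSemialgebraicFunOn_aeval_div_aeval hu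
      (C 2 : MvPolynomial (Fin 1) ℚ) (1 + X 0 ^ 2) (fun x _ => by
        simp only [map_add, map_one, map_pow, MvPolynomial.aeval_X]
        positivity)
    exact h.congr fun x _ => by
      simp only [map_add, map_one, map_pow, MvPolynomial.aeval_X, MvPolynomial.aeval_C, eq_ratCast,
        Rat.cast_ofNat]
  integrableOn := by
    rw [integrableOn_univ]
    have hg : Integrable (fun t : ℝ => 2 / (1 + t ^ 2)) := by
      refine (integrable_inv_one_add_sq.const_mul (2 : ℝ)).congr
        (Filter.Eventually.of_forall fun t => ?_)
      simp only [div_eq_mul_inv]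
    exact ((volume_preserving_funUnique (Fin 1) ℝ).integrable_comp_emb
      (MeasurableEquiv.measurableEmbedding _)).mpr hg

/-- The domain of the target. [folklore] -/
@[simp] theorem twoArctanRep_domain : twoArctanRep.domain = univ := rfl

/-- The integrand of the target. [folklore] -/
@[simp] theorem twoArctanRep_integrand : twoArctanRep.integrand = fun x => 2 / (1 + x 0 ^ 2) := rfl

/-- **Value of the target**: `∫_ℝ 2 dx/(1+x²) = 2π` (Mathlib `integral_univ_inv_one_add_sq`). [folklore] -/
theorem twoArctanRep_value : twoArctanRep.value = 2 * Real.pi := by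
  rw [IntegralRep.value, twoArctanRep_domain, Measure.restrict_univ, twoArctanRep_integrand]
  have h := (volume_preserving_funUnique (Fin 1) ℝ).integral_comp' (fun t : ℝ => 2 / (1 + t ^ 2))
  simp only [MeasurableEquiv.funUnique] at h
  have h2 : ∫ t : ℝ, 2 / (1 + t ^ 2) = 2 * Real.pi := by
    have : (fun t : ℝ => 2 / (1 + t ^ 2)) = fun t => (2 : ℝ) * (1 + t ^ 2)⁻¹ := by
      ext t
      simp only [div_eq_mul_inv]
    rw [this, integral_const_mul, integral_univ_inv_one_add_sq]
  rw [← h2, ← h]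
  rfl

/-- `2π ≠ 0`. [folklore] -/
theorem two_pi_ne_zero : 2 * Real.pi ≠ 0 := by positivity

/-! ## §2 One-dimensional analysis: the half-periods exist (stub-free)

The only analytic input of everything below: `1/√|P|` has inverse-square-root singularities at
the two ends of each gap and is dominated there by `C·(1/√(t−a) + 1/√(b−t))`, which is
integrable (`intervalIntegral.intervalIntegrable_rpow'`, exponent `−1/2 > −1`). -/


/-- `(√(t − a))⁻¹` is integrable on `(a, b)`. [folklore] -/
theorem integrableOn_inv_sqrt_sub_left (a b : ℝ) :
    IntegrableOn (fun t : ℝ => (Real.sqrt (t - a))⁻¹) (Ioo a b) := by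
  rcases le_or_gt b a with hba | hab
  · rw [Ioo_eq_empty (not_lt.2 hba)]
    exact integrableOn_empty
  have h := (intervalIntegral.intervalIntegrable_rpow' (a := 0) (b := b - a) (r := -(1 / 2 : ℝ))
    (by norm_num)).comp_sub_right a
  simp only [zero_add, sub_add_cancel] at h
  rw [intervalIntegrable_iff_integrableOn_Ioo_of_le hab.le] at h
  refine h.congr_fun (fun t ht => ?_) measurableSet_Ioo
  show (t - a) ^ (-(1 / 2 : ℝ)) = (Real.sqrt (t - a))⁻¹
  rw [Real.rpow_neg (sub_pos.2 ht.1).le, ← Real.sqrt_eq_rpow]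

/-- `(√(b − t))⁻¹` is integrable on `(a, b)`. [folklore] -/
theorem integrableOn_inv_sqrt_sub_right (a b : ℝ) :
    IntegrableOn (fun t : ℝ => (Real.sqrt (b - t))⁻¹) (Ioo a b) := by
  rcases le_or_gt b a with hba | hab
  · rw [Ioo_eq_empty (not_lt.2 hba)]
    exact integrableOn_empty
  have h := ((intervalIntegral.intervalIntegrable_rpow' (a := 0) (b := b - a) (r := -(1 / 2 : ℝ))
    (by norm_num)).comp_sub_left b).symm
  simp only [sub_zero, sub_sub_cancel] at h
  rw [intervalIntegrable_iff_integrableOn_Ioo_of_le hab.le] at h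
  refine h.congr_fun (fun t ht => ?_) measurableSet_Ioo
  show (b - t) ^ (-(1 / 2 : ℝ)) = (Real.sqrt (b - t))⁻¹
  rw [Real.rpow_neg (sub_pos.2 ht.2).le, ← Real.sqrt_eq_rpow]

/-- **Inverse-square-root endpoint test.** A function continuous on `(a,b)` and dominated there by
`C·(1/√(t−a) + 1/√(b−t))` is absolutely integrable on `(a,b)`. [folklore] -/
theorem integrableOn_Ioo_of_inv_sqrt_bound {f : ℝ → ℝ} {a b C : ℝ} (hf : ContinuousOn f (Ioo a b))
    (hC : ∀ t ∈ Ioo a b, |f t| ≤ C * ((Real.sqrt (t - a))⁻¹ + (Real.sqrt (b - t))⁻¹)) :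
    IntegrableOn f (Ioo a b) := by
  have hg : IntegrableOn (fun t => C * ((Real.sqrt (t - a))⁻¹ + (Real.sqrt (b - t))⁻¹)) (Ioo a b) :=
    ((integrableOn_inv_sqrt_sub_left a b).add (integrableOn_inv_sqrt_sub_right a b)).const_mul C
  refine Integrable.mono' hg (hf.aestronglyMeasurable measurableSet_Ioo) ?_
  refine (ae_restrict_mem measurableSet_Ioo).mono fun t ht => ?_
  rw [Real.norm_eq_abs]
  exact hC t ht

/-- On the first gap `(e₁,e₂)` of a cubic with real roots `e₁ < e₂ < e₃`:
`1/√|P(t)| ≤ (√(h·d))⁻¹ · (1/√(t−e₁) + 1/√(e₂−t))`, `h = (e₂−e₁)/2`, `d = e₃ − e₂`. [folklore] -/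
theorem inv_sqrt_abs_cubic_le_gap1 {e₁ e₂ e₃ t : ℝ} (h23 : e₂ < e₃) (ht : t ∈ Ioo e₁ e₂) :
    |(Real.sqrt |(t - e₁) * (t - e₂) * (t - e₃)|)⁻¹| ≤
      (Real.sqrt ((e₂ - e₁) / 2 * (e₃ - e₂)))⁻¹ * ((Real.sqrt (t - e₁))⁻¹ + (Real.sqrt (e₂ - t))⁻¹) := by
  obtain ⟨h1, h2⟩ := ht
  set u := t - e₁ with hu
  set v := e₂ - t with hv
  set w := e₃ - t with hw
  have hu0 : 0 < u := sub_pos.2 h1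
  have hv0 : 0 < v := sub_pos.2 h2
  have hd : e₃ - e₂ ≤ w := by rw [hw]; linarith
  have hd0 : 0 < e₃ - e₂ := sub_pos.2 h23
  have hh0 : 0 < (e₂ - e₁) / 2 := by linarith
  have habs : |(t - e₁) * (t - e₂) * (t - e₃)| = u * v * w := by
    rw [show (t - e₁) * (t - e₂) * (t - e₃) = u * v * w by rw [hu, hv, hw]; ring]
    exact abs_of_pos (mul_pos (mul_pos hu0 hv0) (hd0.trans_le hd))
  rw [habs, abs_of_nonneg (inv_nonneg.2 (Real.sqrt_nonneg _))]
  have hK0 : 0 < Real.sqrt ((e₂ - e₁) / 2 * (e₃ - e₂)) := Real.sqrt_pos.2 (mul_pos hh0 hd0)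
  -- case analysis: `u + v = e₂ - e₁`, so `v ≥ h` or `u ≥ h`
  have huv : u + v = e₂ - e₁ := by rw [hu, hv]; ring
  rcases le_or_gt ((e₂ - e₁) / 2) v with hvh | hvh
  · -- `v ≥ h`: `u v w ≥ u · h · d`
    have hle : (e₂ - e₁) / 2 * (e₃ - e₂) * u ≤ u * v * w := by
      have := mul_le_mul hvh hd hd0.le hv0.le
      nlinarith
    have hsq : Real.sqrt ((e₂ - e₁) / 2 * (e₃ - e₂)) * Real.sqrt u ≤ Real.sqrt (u * v * w) := by
      rw [← Real.sqrt_mul (mul_pos hh0 hd0).le]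
      exact Real.sqrt_le_sqrt hle
    have hpos : 0 < Real.sqrt ((e₂ - e₁) / 2 * (e₃ - e₂)) * Real.sqrt u :=
      mul_pos hK0 (Real.sqrt_pos.2 hu0)
    calc (Real.sqrt (u * v * w))⁻¹ ≤ (Real.sqrt ((e₂ - e₁) / 2 * (e₃ - e₂)) * Real.sqrt u)⁻¹ :=
          inv_anti₀ hpos hsq
      _ = (Real.sqrt ((e₂ - e₁) / 2 * (e₃ - e₂)))⁻¹ * (Real.sqrt u)⁻¹ := by rw [mul_inv]
      _ ≤ _ := by
          have : 0 ≤ (Real.sqrt v)⁻¹ := inv_nonneg.2 (Real.sqrt_nonneg _)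
          have hK : 0 ≤ (Real.sqrt ((e₂ - e₁) / 2 * (e₃ - e₂)))⁻¹ := inv_nonneg.2 hK0.le
          nlinarith
  · -- `v < h`, so `u > h`: `u v w ≥ h · v · d`
    have huh : (e₂ - e₁) / 2 ≤ u := by linarith
    have hle : (e₂ - e₁) / 2 * (e₃ - e₂) * v ≤ u * v * w := by
      have := mul_le_mul huh hd hd0.le hu0.le
      nlinarith
    have hsq : Real.sqrt ((e₂ - e₁) / 2 * (e₃ - e₂)) * Real.sqrt v ≤ Real.sqrt (u * v * w) := by
      rw [← Real.sqrt_mul (mul_pos hh0 hd0).le]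
      exact Real.sqrt_le_sqrt hle
    have hpos : 0 < Real.sqrt ((e₂ - e₁) / 2 * (e₃ - e₂)) * Real.sqrt v :=
      mul_pos hK0 (Real.sqrt_pos.2 hv0)
    calc (Real.sqrt (u * v * w))⁻¹ ≤ (Real.sqrt ((e₂ - e₁) / 2 * (e₃ - e₂)) * Real.sqrt v)⁻¹ :=
          inv_anti₀ hpos hsq
      _ = (Real.sqrt ((e₂ - e₁) / 2 * (e₃ - e₂)))⁻¹ * (Real.sqrt v)⁻¹ := by rw [mul_inv]
      _ ≤ _ := by
          have : 0 ≤ (Real.sqrt u)⁻¹ := inv_nonneg.2 (Real.sqrt_nonneg _)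
          have hK : 0 ≤ (Real.sqrt ((e₂ - e₁) / 2 * (e₃ - e₂)))⁻¹ := inv_nonneg.2 hK0.le
          nlinarith

/-- On the second gap `(e₂,e₃)`: `1/√|P(t)| ≤ (√(d'·h'))⁻¹ · (1/√(t−e₂) + 1/√(e₃−t))`,
`d' = e₂ − e₁`, `h' = (e₃−e₂)/2`. [folklore] -/
theorem inv_sqrt_abs_cubic_le_gap2 {e₁ e₂ e₃ t : ℝ} (h12 : e₁ < e₂) (ht : t ∈ Ioo e₂ e₃) :
    |(Real.sqrt |(t - e₁) * (t - e₂) * (t - e₃)|)⁻¹| ≤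
      (Real.sqrt ((e₂ - e₁) * ((e₃ - e₂) / 2)))⁻¹ * ((Real.sqrt (t - e₂))⁻¹ + (Real.sqrt (e₃ - t))⁻¹) := by
  obtain ⟨h1, h2⟩ := ht
  set u := t - e₂ with hu
  set v := e₃ - t with hv
  set w := t - e₁ with hw
  have hu0 : 0 < u := sub_pos.2 h1
  have hv0 : 0 < v := sub_pos.2 h2
  have hd : e₂ - e₁ ≤ w := by rw [hw]; linarith
  have hd0 : 0 < e₂ - e₁ := sub_pos.2 h12
  have hh0 : 0 < (e₃ - e₂) / 2 := by linarith
  have habs : |(t - e₁) * (t - e₂) * (t - e₃)| = w * u * v := by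
    rw [show (t - e₁) * (t - e₂) * (t - e₃) = -(w * u * v) by rw [hu, hv, hw]; ring, abs_neg]
    exact abs_of_pos (mul_pos (mul_pos (hd0.trans_le hd) hu0) hv0)
  rw [habs, abs_of_nonneg (inv_nonneg.2 (Real.sqrt_nonneg _))]
  have hK0 : 0 < Real.sqrt ((e₂ - e₁) * ((e₃ - e₂) / 2)) := Real.sqrt_pos.2 (mul_pos hd0 hh0)
  rcases le_or_gt ((e₃ - e₂) / 2) v with hvh | hvh
  · have hle : (e₂ - e₁) * ((e₃ - e₂) / 2) * u ≤ w * u * v := by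
      have := mul_le_mul hd hvh hh0.le (hd0.le.trans hd)
      nlinarith
    have hsq : Real.sqrt ((e₂ - e₁) * ((e₃ - e₂) / 2)) * Real.sqrt u ≤ Real.sqrt (w * u * v) := by
      rw [← Real.sqrt_mul (mul_pos hd0 hh0).le]
      exact Real.sqrt_le_sqrt hle
    have hpos : 0 < Real.sqrt ((e₂ - e₁) * ((e₃ - e₂) / 2)) * Real.sqrt u :=
      mul_pos hK0 (Real.sqrt_pos.2 hu0)
    calc (Real.sqrt (w * u * v))⁻¹ ≤ (Real.sqrt ((e₂ - e₁) * ((e₃ - e₂) / 2)) * Real.sqrt u)⁻¹ :=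
          inv_anti₀ hpos hsq
      _ = (Real.sqrt ((e₂ - e₁) * ((e₃ - e₂) / 2)))⁻¹ * (Real.sqrt u)⁻¹ := by rw [mul_inv]
      _ ≤ _ := by
          have : 0 ≤ (Real.sqrt v)⁻¹ := inv_nonneg.2 (Real.sqrt_nonneg _)
          have hK : 0 ≤ (Real.sqrt ((e₂ - e₁) * ((e₃ - e₂) / 2)))⁻¹ := inv_nonneg.2 hK0.le
          nlinarith
  · have huh : (e₃ - e₂) / 2 ≤ u := by
      have : u + v = e₃ - e₂ := by rw [hu, hv]; ring
      linarith
    have hle : (e₂ - e₁) * ((e₃ - e₂) / 2) * v ≤ w * u * v := by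
      have := mul_le_mul hd huh hh0.le (hd0.le.trans hd)
      nlinarith
    have hsq : Real.sqrt ((e₂ - e₁) * ((e₃ - e₂) / 2)) * Real.sqrt v ≤ Real.sqrt (w * u * v) := by
      rw [← Real.sqrt_mul (mul_pos hd0 hh0).le]
      exact Real.sqrt_le_sqrt hle
    have hpos : 0 < Real.sqrt ((e₂ - e₁) * ((e₃ - e₂) / 2)) * Real.sqrt v :=
      mul_pos hK0 (Real.sqrt_pos.2 hv0)
    calc (Real.sqrt (w * u * v))⁻¹ ≤ (Real.sqrt ((e₂ - e₁) * ((e₃ - e₂) / 2)) * Real.sqrt v)⁻¹ :=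
          inv_anti₀ hpos hsq
      _ = (Real.sqrt ((e₂ - e₁) * ((e₃ - e₂) / 2)))⁻¹ * (Real.sqrt v)⁻¹ := by rw [mul_inv]
      _ ≤ _ := by
          have : 0 ≤ (Real.sqrt u)⁻¹ := inv_nonneg.2 (Real.sqrt_nonneg _)
          have hK : 0 ≤ (Real.sqrt ((e₂ - e₁) * ((e₃ - e₂) / 2)))⁻¹ := inv_nonneg.2 hK0.le
          nlinarith

/-- `P` has no root in the gaps. [folklore] -/
theorem cubic_ne_zero_of_mem_gap {e₁ e₂ e₃ t : ℝ} (h12 : e₁ < e₂) (h23 : e₂ < e₃)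
    (h : t ∈ Ioo e₁ e₂ ∨ t ∈ Ioo e₂ e₃) : (t - e₁) * (t - e₂) * (t - e₃) ≠ 0 := by
  rcases h with ⟨h1, h2⟩ | ⟨h1, h2⟩
  · exact mul_ne_zero (mul_ne_zero (sub_pos.2 h1).ne' (sub_neg.2 h2).ne) (sub_neg.2 (h2.trans h23)).ne
  · exact mul_ne_zero (mul_ne_zero (sub_pos.2 (h12.trans h1)).ne' (sub_pos.2 h1).ne') (sub_neg.2 h2).ne

/-- **`1/√|P|` is integrable on the first gap `(e₁,e₂)`** (inverse-square-root singularities at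
both ends). [folklore] -/
theorem integrableOn_inv_sqrt_abs_cubic_gap1 {e₁ e₂ e₃ : ℝ} (h12 : e₁ < e₂) (h23 : e₂ < e₃) :
    IntegrableOn (fun t => (Real.sqrt |(t - e₁) * (t - e₂) * (t - e₃)|)⁻¹) (Ioo e₁ e₂) := by
  refine integrableOn_Ioo_of_inv_sqrt_bound ?_ (fun t ht => inv_sqrt_abs_cubic_le_gap1 h23 ht)
  refine ContinuousOn.inv₀ (by fun_prop) fun t ht => ?_
  exact (Real.sqrt_pos.2 (abs_pos.2 (cubic_ne_zero_of_mem_gap h12 h23 (Or.inl ht)))).ne'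

/-- **`1/√|P|` is integrable on the second gap `(e₂,e₃)`**. [folklore] -/
theorem integrableOn_inv_sqrt_abs_cubic_gap2 {e₁ e₂ e₃ : ℝ} (h12 : e₁ < e₂) (h23 : e₂ < e₃) :
    IntegrableOn (fun t => (Real.sqrt |(t - e₁) * (t - e₂) * (t - e₃)|)⁻¹) (Ioo e₂ e₃) := by
  refine integrableOn_Ioo_of_inv_sqrt_bound ?_ (fun t ht => inv_sqrt_abs_cubic_le_gap2 h12 ht)
  refine ContinuousOn.inv₀ (by fun_prop) fun t ht => ?_
  exact (Real.sqrt_pos.2 (abs_pos.2 (cubic_ne_zero_of_mem_gap h12 h23 (Or.inr ht)))).ne'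

/-! ### One-dimensional half-period representations -/


/-- The gap `(a,b)` as a subset of `ℝ¹`. [folklore] -/
def gapSet (a b : ℚ) : Set (Fin 1 → ℝ) := {x | (a : ℝ) < x 0 ∧ x 0 < (b : ℝ)}

/-- `gapSet a b` is `ℚ`-semialgebraic. [folklore] -/
theorem isSemialgebraic_gapSet (a b : ℚ) : IsSemialgebraic ℚ (gapSet a b) := by
  have h1 := isSemialgebraic_setOf_eval_pos (k := ℚ) (R := ℝ) (X 0 - C a : MvPolynomial (Fin 1) ℚ)
  have h2 := isSemialgebraic_setOf_eval_pos (k := ℚ) (R := ℝ) (C b - X 0 : MvPolynomial (Fin 1) ℚ)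
  simp only [map_sub, MvPolynomial.aeval_X, MvPolynomial.aeval_C, eq_ratCast, sub_pos] at h1 h2
  convert h1.inter h2 using 1
  ext x
  simp only [gapSet, mem_setOf_eq, mem_inter_iff]

/-- `gapSet a b` is the preimage of `(a,b)` under `ℝ¹ ≃ ℝ`. [folklore] -/
theorem gapSet_eq_preimage (a b : ℚ) :
    gapSet a b = MeasurableEquiv.funUnique (Fin 1) ℝ ⁻¹' Ioo (a : ℝ) b := by
  ext x
  simp [gapSet, MeasurableEquiv.funUnique, Fin.default_eq_zero]

/-- The one-dimensional representation `[(a,b), h]`. [folklore] -/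
def lineRep (a b : ℚ) (h : ℝ → ℝ) (hh : IsSemialgebraicFunOn ℚ (gapSet a b) (fun x => h (x 0)))
    (hint : IntegrableOn h (Ioo (a : ℝ) b)) : IntegralRep 1 where
  domain := gapSet a b
  integrand := fun x => h (x 0)
  isSemialgebraic_domain := isSemialgebraic_gapSet a b
  isSemialgebraicFunOn_integrand := hh
  integrableOn := by
    rw [gapSet_eq_preimage]
    exact ((volume_preserving_funUnique (Fin 1) ℝ).integrableOn_comp_preimage
      (MeasurableEquiv.measurableEmbedding _)).mpr hint

/-- The domain of `lineRep`. [folklore] -/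
@[simp] theorem lineRep_domain (a b : ℚ) (h : ℝ → ℝ) (hh) (hint) :
    (lineRep a b h hh hint).domain = gapSet a b := rfl

/-- The integrand of `lineRep`. [folklore] -/
@[simp] theorem lineRep_integrand (a b : ℚ) (h : ℝ → ℝ) (hh) (hint) :
    (lineRep a b h hh hint).integrand = fun x => h (x 0) := rfl

/-- The value of `lineRep a b h` is `∫_{(a,b)} h`. [folklore] -/
theorem lineRep_value (a b : ℚ) (h : ℝ → ℝ) (hh) (hint) :
    (lineRep a b h hh hint).value = ∫ t in Ioo (a : ℝ) b, h t := by
  change ∫ x in gapSet a b, h (x 0) = _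
  rw [gapSet_eq_preimage, ← (volume_preserving_funUnique (Fin 1) ℝ).setIntegral_preimage_emb
    (MeasurableEquiv.measurableEmbedding _) h (Ioo (a : ℝ) b)]
  rfl

/-- `k(t) = 1/√|P(t)|`, the common density of the four half-periods. [folklore] -/
def kFun (e₁ e₂ e₃ : ℚ) (t : ℝ) : ℝ := (Real.sqrt |(t - e₁) * (t - e₂) * (t - e₃)|)⁻¹

/-- `|P| = P` on the first gap and `|P| = −P` on the second (as `ℚ`-polynomial identities usable
under `aeval`). [folklore] -/
theorem abs_cubic_eq_gap1 {e₁ e₂ e₃ : ℚ} {t : ℝ} (h23 : e₂ < e₃) (ht : t ∈ Ioo (e₁ : ℝ) e₂) :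
    |(t - e₁) * (t - e₂) * (t - e₃)| = (t - e₁) * (t - e₂) * (t - e₃) := by
  have h23' : (e₂ : ℝ) < e₃ := Rat.cast_lt.2 h23
  refine abs_of_pos ?_
  have := mul_pos_of_neg_of_neg (sub_neg.2 ht.2) (sub_neg.2 (ht.2.trans h23'))
  nlinarith [sub_pos.2 ht.1]

theorem abs_cubic_eq_gap2 {e₁ e₂ e₃ : ℚ} {t : ℝ} (h12 : e₁ < e₂) (ht : t ∈ Ioo (e₂ : ℝ) e₃) :
    |(t - e₁) * (t - e₂) * (t - e₃)| = -((t - e₁) * (t - e₂) * (t - e₃)) := by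
  have h12' : (e₁ : ℝ) < e₂ := Rat.cast_lt.2 h12
  refine abs_of_neg ?_
  exact mul_neg_of_pos_of_neg (mul_pos (sub_pos.2 (h12'.trans ht.1)) (sub_pos.2 ht.1)) (sub_neg.2 ht.2)

/-- `x ↦ k(x₀)` is `ℚ`-semialgebraic on the first gap. [folklore] -/
theorem isSemialgebraicFunOn_kFun_gap1 {e₁ e₂ e₃ : ℚ} (h12 : e₁ < e₂) (h23 : e₂ < e₃) :
    IsSemialgebraicFunOn ℚ (gapSet e₁ e₂) (fun x => kFun e₁ e₂ e₃ (x 0)) := by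
  have hσ := isSemialgebraic_gapSet e₁ e₂
  have hP := isSemialgebraicFunOn_aeval hσ ((X 0 - C e₁) * (X 0 - C e₂) * (X 0 - C e₃) : MvPolynomial (Fin 1) ℚ)
  have hP' : IsSemialgebraicFunOn ℚ (gapSet e₁ e₂) (fun x => |(x 0 - e₁) * (x 0 - e₂) * (x 0 - e₃)|) := by
    refine hP.congr fun x hx => ?_
    rw [abs_cubic_eq_gap1 h23 hx]
    simp only [map_mul, map_sub, MvPolynomial.aeval_X, MvPolynomial.aeval_C, eq_ratCast]
  have hs := IsSemialgebraicFunOn.sqrt_holds hP'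
  have h1 := isSemialgebraicFunOn_ratCast hσ 1
  refine ((h1.div hs) fun x hx => ?_).congr fun x _ => ?_
  · exact (Real.sqrt_pos.2 (abs_pos.2 (cubic_ne_zero_of_mem_gap (Rat.cast_lt.2 h12) (Rat.cast_lt.2 h23)
      (Or.inl hx)))).ne'
  · simp [kFun]

/-- `x ↦ k(x₀)` is `ℚ`-semialgebraic on the second gap. [folklore] -/
theorem isSemialgebraicFunOn_kFun_gap2 {e₁ e₂ e₃ : ℚ} (h12 : e₁ < e₂) (h23 : e₂ < e₃) :
    IsSemialgebraicFunOn ℚ (gapSet e₂ e₃) (fun x => kFun e₁ e₂ e₃ (x 0)) := by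
  have hσ := isSemialgebraic_gapSet e₂ e₃
  have hP := isSemialgebraicFunOn_aeval hσ (-((X 0 - C e₁) * (X 0 - C e₂) * (X 0 - C e₃)) : MvPolynomial (Fin 1) ℚ)
  have hP' : IsSemialgebraicFunOn ℚ (gapSet e₂ e₃) (fun x => |(x 0 - e₁) * (x 0 - e₂) * (x 0 - e₃)|) := by
    refine hP.congr fun x hx => ?_
    rw [abs_cubic_eq_gap2 h12 hx]
    simp only [map_neg, map_mul, map_sub, MvPolynomial.aeval_X, MvPolynomial.aeval_C, eq_ratCast]
  have hs := IsSemialgebraicFunOn.sqrt_holds hP'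
  have h1 := isSemialgebraicFunOn_ratCast hσ 1
  refine ((h1.div hs) fun x hx => ?_).congr fun x _ => ?_
  · exact (Real.sqrt_pos.2 (abs_pos.2 (cubic_ne_zero_of_mem_gap (Rat.cast_lt.2 h12) (Rat.cast_lt.2 h23)
      (Or.inr hx)))).ne'
  · simp [kFun]

/-- `x ↦ x₀ · k(x₀)` is `ℚ`-semialgebraic wherever `k` is. [folklore] -/
theorem isSemialgebraicFunOn_mul_kFun {e₁ e₂ e₃ a b : ℚ}
    (hk : IsSemialgebraicFunOn ℚ (gapSet a b) (fun x => kFun e₁ e₂ e₃ (x 0))) :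
    IsSemialgebraicFunOn ℚ (gapSet a b) (fun x => x 0 * kFun e₁ e₂ e₃ (x 0)) := by
  have hX := isSemialgebraicFunOn_aeval (isSemialgebraic_gapSet a b) (X 0 : MvPolynomial (Fin 1) ℚ)
  refine (IsSemialgebraicFunOn.mul_holds hX hk).congr fun x _ => ?_
  simp

/-- `t ↦ t · k(t)` is integrable on a gap where `k` is (bounded continuous factor). [folklore] -/
theorem integrableOn_mul_kFun {e₁ e₂ e₃ : ℚ} {a b : ℝ}
    (hk : IntegrableOn (kFun e₁ e₂ e₃) (Ioo a b)) :
    IntegrableOn (fun t => t * kFun e₁ e₂ e₃ t) (Ioo a b) :=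
  hk.continuousOn_mul_of_subset continuousOn_id isCompact_Icc measurableSet_Ioo Ioo_subset_Icc_self

/-- `[J₁, k]`, value `I₁⁰`. [folklore] -/
def k1Rep (e₁ e₂ e₃ : ℚ) (h12 : e₁ < e₂) (h23 : e₂ < e₃) : IntegralRep 1 :=
  lineRep e₁ e₂ (kFun e₁ e₂ e₃) (isSemialgebraicFunOn_kFun_gap1 h12 h23)
    (integrableOn_inv_sqrt_abs_cubic_gap1 (Rat.cast_lt.2 h12) (Rat.cast_lt.2 h23))

/-- `[J₁, t·k]`, value `I₁¹`. [folklore] -/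
def xk1Rep (e₁ e₂ e₃ : ℚ) (h12 : e₁ < e₂) (h23 : e₂ < e₃) : IntegralRep 1 :=
  lineRep e₁ e₂ (fun t => t * kFun e₁ e₂ e₃ t) (isSemialgebraicFunOn_mul_kFun (isSemialgebraicFunOn_kFun_gap1 h12 h23))
    (integrableOn_mul_kFun (integrableOn_inv_sqrt_abs_cubic_gap1 (Rat.cast_lt.2 h12) (Rat.cast_lt.2 h23)))

/-- `[J₂, k]`, value `I₂⁰`. [folklore] -/
def k2Rep (e₁ e₂ e₃ : ℚ) (h12 : e₁ < e₂) (h23 : e₂ < e₃) : IntegralRep 1 :=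
  lineRep e₂ e₃ (kFun e₁ e₂ e₃) (isSemialgebraicFunOn_kFun_gap2 h12 h23)
    (integrableOn_inv_sqrt_abs_cubic_gap2 (Rat.cast_lt.2 h12) (Rat.cast_lt.2 h23))

/-- `[J₂, t·k]`, value `I₂¹`. [folklore] -/
def xk2Rep (e₁ e₂ e₃ : ℚ) (h12 : e₁ < e₂) (h23 : e₂ < e₃) : IntegralRep 1 :=
  lineRep e₂ e₃ (fun t => t * kFun e₁ e₂ e₃ t) (isSemialgebraicFunOn_mul_kFun (isSemialgebraicFunOn_kFun_gap2 h12 h23))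
    (integrableOn_mul_kFun (integrableOn_inv_sqrt_abs_cubic_gap2 (Rat.cast_lt.2 h12) (Rat.cast_lt.2 h23)))

/-- The half-period `I_J^m = ∫_J t^m dt/√|P(t)|` over the gap `J = (a,b)`, `m ∈ {0,1}`. [folklore] -/
def halfPeriod (e₁ e₂ e₃ : ℚ) (a b : ℚ) (m : ℕ) : ℝ :=
  ∫ t in Ioo (a : ℝ) b, t ^ m * kFun e₁ e₂ e₃ t

theorem k1Rep_value (e₁ e₂ e₃ : ℚ) (h12 : e₁ < e₂) (h23 : e₂ < e₃) :
    (k1Rep e₁ e₂ e₃ h12 h23).value = halfPeriod e₁ e₂ e₃ e₁ e₂ 0 := by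
  rw [k1Rep, lineRep_value, halfPeriod]
  simp

theorem xk1Rep_value (e₁ e₂ e₃ : ℚ) (h12 : e₁ < e₂) (h23 : e₂ < e₃) :
    (xk1Rep e₁ e₂ e₃ h12 h23).value = halfPeriod e₁ e₂ e₃ e₁ e₂ 1 := by
  rw [xk1Rep, lineRep_value, halfPeriod]
  simp

theorem k2Rep_value (e₁ e₂ e₃ : ℚ) (h12 : e₁ < e₂) (h23 : e₂ < e₃) :
    (k2Rep e₁ e₂ e₃ h12 h23).value = halfPeriod e₁ e₂ e₃ e₂ e₃ 0 := by
  rw [k2Rep, lineRep_value, halfPeriod]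
  simp

theorem xk2Rep_value (e₁ e₂ e₃ : ℚ) (h12 : e₁ < e₂) (h23 : e₂ < e₃) :
    (xk2Rep e₁ e₂ e₃ h12 h23).value = halfPeriod e₁ e₂ e₃ e₂ e₃ 1 := by
  rw [xk2Rep, lineRep_value, halfPeriod]
  simp

/-! ### The crux integrand as a difference of two Fubini products -/

/-- The open rectangle `(a,b) × (c,d)` is the product domain of two line representations. [folklore] -/
theorem prodDomain_lineRep (a b c d : ℚ) (h h' : ℝ → ℝ) (hh hh' hint hint') :
    IntegralRep.prodDomain (lineRep a b h hh hint) (lineRep c d h' hh' hint') =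
      {x : Fin 2 → ℝ | (a : ℝ) < x 0 ∧ x 0 < (b : ℝ) ∧ (c : ℝ) < x 1 ∧ x 1 < (d : ℝ)} := by
  ext z
  simp only [IntegralRep.mem_prodDomain, lineRep_domain, gapSet, mem_setOf_eq]
  constructor
  · rintro ⟨⟨h0, h1⟩, h2, h3⟩
    exact ⟨h0, h1, h2, h3⟩
  · rintro ⟨h0, h1, h2, h3⟩
    exact ⟨⟨h0, h1⟩, h2, h3⟩

/-- The product function of two line representations. [folklore] -/
theorem prodFun_lineRep (a b c d : ℚ) (h h' : ℝ → ℝ) (hh hh' hint hint') (z : Fin 2 → ℝ) :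
    IntegralRep.prodFun (lineRep a b h hh hint) (lineRep c d h' hh' hint') z = h (z 0) * h' (z 1) := by
  simp only [IntegralRep.prodFun_apply, lineRep_integrand]
  rfl

/-- **Pointwise**: `g(x) = k(x₀)·(x₁ k(x₁)) − (x₀ k(x₀))·k(x₁)` (i.e. `(x₁ − x₀) k(x₀) k(x₁)`,
`√(|P(x₀)||P(x₁)|) = √|P(x₀)| · √|P(x₁)|`). [folklore] -/
theorem cubicIntegrand_eq_sub (e₁ e₂ e₃ : ℚ) (x : Fin 2 → ℝ) :
    (x 1 - x 0) / Real.sqrt (|(x 0 - (e₁ : ℝ)) * (x 0 - (e₂ : ℝ)) * (x 0 - (e₃ : ℝ))| *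
        |(x 1 - (e₁ : ℝ)) * (x 1 - (e₂ : ℝ)) * (x 1 - (e₃ : ℝ))|) =
      kFun e₁ e₂ e₃ (x 0) * (x 1 * kFun e₁ e₂ e₃ (x 1)) -
        x 0 * kFun e₁ e₂ e₃ (x 0) * kFun e₁ e₂ e₃ (x 1) := by
  rw [Real.sqrt_mul (abs_nonneg _)]
  simp only [kFun]
  ring


/-- Semialgebraicity of product functions (Tarski–Seidenberg, tree theorem `mul_holds`). [folklore] -/
theorem prodFunSemialgebraic_holds : ProdFunSemialgebraic :=
  prodFunSemialgebraic_of_mul fun {_ _ _ _} => IsSemialgebraicFunOn.mul_holds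

/-- **Legendre's combination in literal form**: for rational `e₁ < e₂ < e₃`,
`∫_{(e₁,e₂)×(e₂,e₃)} (x₁−x₀) dx/√(|P(x₀)||P(x₁)|) = I₁⁰·I₂¹ − I₁¹·I₂⁰` (two Fubini products,
`KZ.IntegralRep.setIntegral_prodFun`). [folklore] -/
theorem setIntegral_cubic_eq_halfPeriods (e₁ e₂ e₃ : ℚ) (h12 : e₁ < e₂) (h23 : e₂ < e₃) :
    ∫ x in {x : Fin 2 → ℝ | (e₁ : ℝ) < x 0 ∧ x 0 < (e₂ : ℝ) ∧ (e₂ : ℝ) < x 1 ∧ x 1 < (e₃ : ℝ)},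
        (x 1 - x 0) / Real.sqrt (|(x 0 - (e₁ : ℝ)) * (x 0 - (e₂ : ℝ)) * (x 0 - (e₃ : ℝ))| *
          |(x 1 - (e₁ : ℝ)) * (x 1 - (e₂ : ℝ)) * (x 1 - (e₃ : ℝ))|) =
      halfPeriod e₁ e₂ e₃ e₁ e₂ 0 * halfPeriod e₁ e₂ e₃ e₂ e₃ 1 -
        halfPeriod e₁ e₂ e₃ e₁ e₂ 1 * halfPeriod e₁ e₂ e₃ e₂ e₃ 0 := by
  set r₁ := k1Rep e₁ e₂ e₃ h12 h23 with hr₁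
  set s₁ := xk2Rep e₁ e₂ e₃ h12 h23 with hs₁
  set r₂ := xk1Rep e₁ e₂ e₃ h12 h23 with hr₂
  set s₂ := k2Rep e₁ e₂ e₃ h12 h23 with hs₂
  have hD₁ : IntegralRep.prodDomain r₁ s₁ =
      {x : Fin 2 → ℝ | (e₁ : ℝ) < x 0 ∧ x 0 < (e₂ : ℝ) ∧ (e₂ : ℝ) < x 1 ∧ x 1 < (e₃ : ℝ)} :=
    prodDomain_lineRep _ _ _ _ _ _ _ _ _ _
  have hD₂ : IntegralRep.prodDomain r₂ s₂ =
      {x : Fin 2 → ℝ | (e₁ : ℝ) < x 0 ∧ x 0 < (e₂ : ℝ) ∧ (e₂ : ℝ) < x 1 ∧ x 1 < (e₃ : ℝ)} :=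
    prodDomain_lineRep _ _ _ _ _ _ _ _ _ _
  have hmeas : MeasurableSet
      {x : Fin 2 → ℝ | (e₁ : ℝ) < x 0 ∧ x 0 < (e₂ : ℝ) ∧ (e₂ : ℝ) < x 1 ∧ x 1 < (e₃ : ℝ)} := by
    rw [← hD₁]
    exact IntegralRep.measurableSet_domain_holds (r₁.prod s₁)
  have hF : IntegrableOn (IntegralRep.prodFun r₁ s₁)
      {x : Fin 2 → ℝ | (e₁ : ℝ) < x 0 ∧ x 0 < (e₂ : ℝ) ∧ (e₂ : ℝ) < x 1 ∧ x 1 < (e₃ : ℝ)} :=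
    hD₁ ▸ IntegralRep.integrableOn_prodFun r₁ s₁
  have hG : IntegrableOn (IntegralRep.prodFun r₂ s₂)
      {x : Fin 2 → ℝ | (e₁ : ℝ) < x 0 ∧ x 0 < (e₂ : ℝ) ∧ (e₂ : ℝ) < x 1 ∧ x 1 < (e₃ : ℝ)} :=
    hD₂ ▸ IntegralRep.integrableOn_prodFun r₂ s₂
  have hcongr : EqOn (fun x : Fin 2 → ℝ => (x 1 - x 0) / Real.sqrt (|(x 0 - (e₁ : ℝ)) * (x 0 - (e₂ : ℝ)) *
      (x 0 - (e₃ : ℝ))| * |(x 1 - (e₁ : ℝ)) * (x 1 - (e₂ : ℝ)) * (x 1 - (e₃ : ℝ))|))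
      (fun x => IntegralRep.prodFun r₁ s₁ x - IntegralRep.prodFun r₂ s₂ x)
      {x : Fin 2 → ℝ | (e₁ : ℝ) < x 0 ∧ x 0 < (e₂ : ℝ) ∧ (e₂ : ℝ) < x 1 ∧ x 1 < (e₃ : ℝ)} := by
    intro x _
    simp only [hr₁, hs₁, hr₂, hs₂, k1Rep, xk1Rep, k2Rep, xk2Rep, prodFun_lineRep]
    rw [cubicIntegrand_eq_sub]
  have h1 : ∫ x in {x : Fin 2 → ℝ | (e₁ : ℝ) < x 0 ∧ x 0 < (e₂ : ℝ) ∧ (e₂ : ℝ) < x 1 ∧ x 1 < (e₃ : ℝ)},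
      IntegralRep.prodFun r₁ s₁ x = r₁.value * s₁.value := by
    rw [← hD₁]
    exact IntegralRep.setIntegral_prodFun r₁ s₁
  have h2 : ∫ x in {x : Fin 2 → ℝ | (e₁ : ℝ) < x 0 ∧ x 0 < (e₂ : ℝ) ∧ (e₂ : ℝ) < x 1 ∧ x 1 < (e₃ : ℝ)},
      IntegralRep.prodFun r₂ s₂ x = r₂.value * s₂.value := by
    rw [← hD₂]
    exact IntegralRep.setIntegral_prodFun r₂ s₂
  rw [setIntegral_congr_fun hmeas hcongr, integral_sub hF hG, h1, h2, hr₁, hs₁, hr₂, hs₂, k1Rep_value,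
    xk2Rep_value, xk1Rep_value, k2Rep_value]

/-! ### The same-gap rectangle: value `0` -/

/-- **The same-gap representation** `[(e₁,e₂)², g]` exists (integrand: the crux's formula
verbatim; integrable as a difference of two Fubini products). [folklore] -/
def sameGapRep (e₁ e₂ e₃ : ℚ) (h12 : e₁ < e₂) (h23 : e₂ < e₃) : IntegralRep 2 where
  domain := {x : Fin 2 → ℝ | (e₁ : ℝ) < x 0 ∧ x 0 < (e₂ : ℝ) ∧ (e₁ : ℝ) < x 1 ∧ x 1 < (e₂ : ℝ)}
  integrand := fun x => (x 1 - x 0) / Real.sqrt (|(x 0 - (e₁ : ℝ)) * (x 0 - (e₂ : ℝ)) * (x 0 - (e₃ : ℝ))| *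
    |(x 1 - (e₁ : ℝ)) * (x 1 - (e₂ : ℝ)) * (x 1 - (e₃ : ℝ))|)
  isSemialgebraic_domain := by
    rw [← prodDomain_lineRep e₁ e₂ e₁ e₂ _ _ _ _ _ _]
    exact IntegralRep.isSemialgebraic_prodDomain (k1Rep e₁ e₂ e₃ h12 h23) (xk1Rep e₁ e₂ e₃ h12 h23)
  isSemialgebraicFunOn_integrand := by
    have h1 := prodFunSemialgebraic_holds (k1Rep e₁ e₂ e₃ h12 h23) (xk1Rep e₁ e₂ e₃ h12 h23)
    have h2 := prodFunSemialgebraic_holds (xk1Rep e₁ e₂ e₃ h12 h23) (k1Rep e₁ e₂ e₃ h12 h23)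
    rw [show IntegralRep.prodDomain (xk1Rep e₁ e₂ e₃ h12 h23) (k1Rep e₁ e₂ e₃ h12 h23) =
      IntegralRep.prodDomain (k1Rep e₁ e₂ e₃ h12 h23) (xk1Rep e₁ e₂ e₃ h12 h23) by
        rw [k1Rep, xk1Rep, prodDomain_lineRep, prodDomain_lineRep]] at h2
    have h := IsSemialgebraicFunOn.sub_holds h1 h2
    rw [k1Rep, xk1Rep, prodDomain_lineRep] at h
    refine h.congr fun x _ => ?_
    simp only [prodFun_lineRep, Pi.sub_apply]
    rw [cubicIntegrand_eq_sub]
  integrableOn := by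
    have h1 := IntegralRep.integrableOn_prodFun (k1Rep e₁ e₂ e₃ h12 h23) (xk1Rep e₁ e₂ e₃ h12 h23)
    have h2 := IntegralRep.integrableOn_prodFun (xk1Rep e₁ e₂ e₃ h12 h23) (k1Rep e₁ e₂ e₃ h12 h23)
    rw [k1Rep, xk1Rep, prodDomain_lineRep] at h1 h2
    refine (h1.sub h2).congr_fun (fun x _ => ?_) ?_
    · simp only [prodFun_lineRep, Pi.sub_apply]
      rw [cubicIntegrand_eq_sub]
    · rw [← prodDomain_lineRep e₁ e₂ e₁ e₂ _ _ _ _ _ _]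
      exact IntegralRep.measurableSet_domain_holds ((k1Rep e₁ e₂ e₃ h12 h23).prod (xk1Rep e₁ e₂ e₃ h12 h23))

/-- **The same-gap rectangle has value `0`**: `∫ = I₁⁰·I₁¹ − I₁¹·I₁⁰`. [folklore] -/
theorem sameGapRep_value (e₁ e₂ e₃ : ℚ) (h12 : e₁ < e₂) (h23 : e₂ < e₃) :
    (sameGapRep e₁ e₂ e₃ h12 h23).value = 0 := by
  set r₁ := k1Rep e₁ e₂ e₃ h12 h23 with hr₁
  set s₁ := xk1Rep e₁ e₂ e₃ h12 h23 with hs₁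
  have hD₁ : IntegralRep.prodDomain r₁ s₁ = (sameGapRep e₁ e₂ e₃ h12 h23).domain :=
    prodDomain_lineRep _ _ _ _ _ _ _ _ _ _
  have hD₂ : IntegralRep.prodDomain s₁ r₁ = (sameGapRep e₁ e₂ e₃ h12 h23).domain :=
    prodDomain_lineRep _ _ _ _ _ _ _ _ _ _
  have hmeas : MeasurableSet (sameGapRep e₁ e₂ e₃ h12 h23).domain :=
    IntegralRep.measurableSet_domain_holds _
  have hF : IntegrableOn (IntegralRep.prodFun r₁ s₁) (sameGapRep e₁ e₂ e₃ h12 h23).domain :=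
    hD₁ ▸ IntegralRep.integrableOn_prodFun r₁ s₁
  have hG : IntegrableOn (IntegralRep.prodFun s₁ r₁) (sameGapRep e₁ e₂ e₃ h12 h23).domain :=
    hD₂ ▸ IntegralRep.integrableOn_prodFun s₁ r₁
  have hcongr : EqOn (sameGapRep e₁ e₂ e₃ h12 h23).integrand
      (fun x => IntegralRep.prodFun r₁ s₁ x - IntegralRep.prodFun s₁ r₁ x)
      (sameGapRep e₁ e₂ e₃ h12 h23).domain := by
    intro x _
    simp only [sameGapRep, hr₁, hs₁, k1Rep, xk1Rep, prodFun_lineRep]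
    rw [cubicIntegrand_eq_sub]
  have h1 : ∫ x in (sameGapRep e₁ e₂ e₃ h12 h23).domain, IntegralRep.prodFun r₁ s₁ x =
      r₁.value * s₁.value := by
    rw [← hD₁]
    exact IntegralRep.setIntegral_prodFun r₁ s₁
  have h2 : ∫ x in (sameGapRep e₁ e₂ e₃ h12 h23).domain, IntegralRep.prodFun s₁ r₁ x =
      s₁.value * r₁.value := by
    rw [← hD₂]
    exact IntegralRep.setIntegral_prodFun s₁ r₁
  rw [IntegralRep.value, setIntegral_congr_fun hmeas hcongr, integral_sub hF hG, h1, h2]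
  ring


/-! ## §3 Non-vacuity: the crux's left representation exists (stub-free) -/

/-- **NON-VACUITY: the crux's left representation `r₀ = [R, g]` EXISTS** — integrand the crux's
formula verbatim, integrable on `R` as the difference of two Fubini products
`[J₁, k]·[J₂, t k] − [J₁, t k]·[J₂, k]` (no estimate at the branch edge `x₁ = e₂` or at the corner
`(e₂,e₂)` is needed). [folklore] -/
def cubicRep (e₁ e₂ e₃ : ℚ) (h12 : e₁ < e₂) (h23 : e₂ < e₃) : IntegralRep 2 where
  domain := box e₁ e₂ e₃
  integrand := cubicIntegrand e₁ e₂ e₃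
  isSemialgebraic_domain := isSemialgebraic_box e₁ e₂ e₃
  isSemialgebraicFunOn_integrand := by
    have h1 := prodFunSemialgebraic_holds (k1Rep e₁ e₂ e₃ h12 h23) (xk2Rep e₁ e₂ e₃ h12 h23)
    have h2 := prodFunSemialgebraic_holds (xk1Rep e₁ e₂ e₃ h12 h23) (k2Rep e₁ e₂ e₃ h12 h23)
    rw [show IntegralRep.prodDomain (xk1Rep e₁ e₂ e₃ h12 h23) (k2Rep e₁ e₂ e₃ h12 h23) =
      IntegralRep.prodDomain (k1Rep e₁ e₂ e₃ h12 h23) (xk2Rep e₁ e₂ e₃ h12 h23) by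
        rw [k1Rep, xk1Rep, k2Rep, xk2Rep, prodDomain_lineRep, prodDomain_lineRep]] at h2
    have h := IsSemialgebraicFunOn.sub_holds h1 h2
    rw [k1Rep, xk2Rep, prodDomain_lineRep] at h
    refine h.congr fun x _ => ?_
    simp only [xk1Rep, k2Rep, prodFun_lineRep, Pi.sub_apply, cubicIntegrand]
    rw [cubicIntegrand_eq_sub]
  integrableOn := by
    have h1 := IntegralRep.integrableOn_prodFun (k1Rep e₁ e₂ e₃ h12 h23) (xk2Rep e₁ e₂ e₃ h12 h23)
    have h2 := IntegralRep.integrableOn_prodFun (xk1Rep e₁ e₂ e₃ h12 h23) (k2Rep e₁ e₂ e₃ h12 h23)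
    rw [k1Rep, xk2Rep, prodDomain_lineRep] at h1
    rw [xk1Rep, k2Rep, prodDomain_lineRep] at h2
    refine (h1.sub h2).congr_fun (fun x _ => ?_)
      (IsSemialgebraic.measurableSet_holds (isSemialgebraic_box e₁ e₂ e₃))
    simp only [prodFun_lineRep, Pi.sub_apply, cubicIntegrand]
    rw [cubicIntegrand_eq_sub]

/-- The domain of `r₀`. [folklore] -/
@[simp] theorem cubicRep_domain (e₁ e₂ e₃ : ℚ) (h12 : e₁ < e₂) (h23 : e₂ < e₃) :
    (cubicRep e₁ e₂ e₃ h12 h23).domain = box e₁ e₂ e₃ := rfl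

/-- The integrand of `r₀`. [folklore] -/
@[simp] theorem cubicRep_integrand (e₁ e₂ e₃ : ℚ) (h12 : e₁ < e₂) (h23 : e₂ < e₃) :
    (cubicRep e₁ e₂ e₃ h12 h23).integrand = cubicIntegrand e₁ e₂ e₃ := rfl

/-- **Literal form of the value**: `value r₀ = I₁⁰·I₂¹ − I₁¹·I₂⁰`. [folklore] -/
theorem cubicRep_value_eq_halfPeriods (e₁ e₂ e₃ : ℚ) (h12 : e₁ < e₂) (h23 : e₂ < e₃) :
    (cubicRep e₁ e₂ e₃ h12 h23).value =
      halfPeriod e₁ e₂ e₃ e₁ e₂ 0 * halfPeriod e₁ e₂ e₃ e₂ e₃ 1 -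
        halfPeriod e₁ e₂ e₃ e₁ e₂ 1 * halfPeriod e₁ e₂ e₃ e₂ e₃ 0 :=
  setIntegral_cubic_eq_halfPeriods e₁ e₂ e₃ h12 h23

/-- **Reduction to the canonical pair** (the `∀ r r'` shape and off-domain values are harmless:
identity changes of variables, `equivalent_of_eqOn`); in particular the hypotheses of the crux are
satisfiable. [folklore] -/
theorem legendreCubicForm_iff_canonical : LegendreCubicForm ↔
    ∀ (e₁ e₂ e₃ : ℚ) (h12 : e₁ < e₂) (h23 : e₂ < e₃),
      Equivalent (cubicRep e₁ e₂ e₃ h12 h23) twoArctanRep := by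
  constructor
  · intro h e₁ e₂ e₃ h12 h23
    exact h e₁ e₂ e₃ h12 h23 _ _ rfl (fun x _ => rfl) rfl (fun x _ => rfl)
  · intro h e₁ e₂ e₃ h12 h23 r r' hd hf hd' hf'
    have h1 : Equivalent r (cubicRep e₁ e₂ e₃ h12 h23) :=
      equivalent_of_eqOn r _ (by rw [cubicRep_domain, hd]; rfl) hf
    have h2 : Equivalent twoArctanRep r' :=
      equivalent_of_eqOn twoArctanRep r' (by rw [hd', twoArctanRep_domain]) fun x _ => by
        have hx : x ∈ r'.domain := by rw [hd']; trivial
        exact (hf' hx).symm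
    exact h1.trans ((h e₁ e₂ e₃ h12 h23).trans h2)

/-! ## §4 The value `2π`: Legendre's relation for every rational cubic (from the landed stubs)

The six landed stubs of line `Sketch` compose (exactly as in the lead's skeleton
`Cruxes/LegendreCubicForm/Lines/Sketch.lean`) to `[r₀] ~ [ℝ, 2/(1+x²)]`; by soundness
(`KZ.Equivalent.value_eq_holds`) `value r₀ = 2π`. With §3 this is the classical Legendre relation
`I₁⁰I₂¹ − I₁¹I₂⁰ = 2π` (`= (η₁ω₂ − η₂ω₁)/(4i)` for the monic cubic, Whittaker–Watson §20.411 after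
`y ↦ 2y`), now a kernel-checked theorem for all rational `e₁ < e₂ < e₃`. Consequently NO
evaluation invariant can separate the crux's pair, and a refutation of the crux as typed is
impossible (it is a theorem). -/

/-- **`value r₀ = 2π`** (six landed stubs of line `Sketch` + soundness of the calculus).
[cite: KontsevichZagier2001, §1.2] -/
theorem cubicRep_value {e₁ e₂ e₃ : ℚ} (h12 : e₁ < e₂) (h23 : e₂ < e₃) :
    (cubicRep e₁ e₂ e₃ h12 h23).value = 2 * Real.pi := by
  have hE : Equivalent (cubicRep e₁ e₂ e₃ h12 h23) twoArctanRep := by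
    obtain ⟨p, hpd, hpi, hcov⟩ :=
      stub_hatBoxTransfer e₁ e₂ e₃ h12 h23 (stub_hatBoxInjOn e₁ e₂ e₃ h12 h23)
        (stub_hatBoxImage e₁ e₂ e₃ h12 h23) (stub_hatBoxJacobian e₁ e₂ e₃ h12 h23)
        (cubicRep e₁ e₂ e₃ h12 h23) rfl (fun x _ => rfl)
    have hrp : Equivalent (cubicRep e₁ e₂ e₃ h12 h23) p := changeOfVariablesRel_subset_relations hcov
    obtain ⟨q, hqd, hqi, hpq⟩ := stub_heightNewtonLeibniz p hpd (by rw [hpi]; exact fun _ _ => rfl)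
    have hqr' : Equivalent q twoArctanRep :=
      stub_arctanTail q twoArctanRep hqd (by rw [hqi]; exact fun _ _ => rfl) rfl (fun _ _ => rfl)
    exact (hrp.trans hpq).trans hqr'
  rw [← twoArctanRep_value]
  exact Equivalent.value_eq_holds hE

/-- **Legendre's relation for rational cubics**: `I₁⁰·I₂¹ − I₁¹·I₂⁰ = 2π`, where
`I_j^m = ∫_{J_j} t^m dt/√|(t−e₁)(t−e₂)(t−e₃)|`, `J₁ = (e₁,e₂)`, `J₂ = (e₂,e₃)`.
[cite: KontsevichZagier2001, §1.2] -/
theorem legendre_relation {e₁ e₂ e₃ : ℚ} (h12 : e₁ < e₂) (h23 : e₂ < e₃) :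
    halfPeriod e₁ e₂ e₃ e₁ e₂ 0 * halfPeriod e₁ e₂ e₃ e₂ e₃ 1 -
        halfPeriod e₁ e₂ e₃ e₁ e₂ 1 * halfPeriod e₁ e₂ e₃ e₂ e₃ 0 = 2 * Real.pi := by
  rw [← cubicRep_value_eq_halfPeriods e₁ e₂ e₃ h12 h23, cubicRep_value h12 h23]

/-- The same, printed as the crux's set integral. [folklore] -/
theorem setIntegral_cubicIntegrand {e₁ e₂ e₃ : ℚ} (h12 : e₁ < e₂) (h23 : e₂ < e₃) :
    ∫ x in box e₁ e₂ e₃, cubicIntegrand e₁ e₂ e₃ x = 2 * Real.pi :=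
  cubicRep_value h12 h23

/-! ## §5 Load-bearing hypotheses

The crux has six hypotheses: the order `e₁ < e₂`, `e₂ < e₃` and the four pinning hypotheses
`hD : r.domain = R`, `hF : r.integrand = g on R`, `hD' : r'.domain = ℝ`, `hF' : r'.integrand =
2/(1+x²) on ℝ`. Dropping any ONE gives a false statement ("any proof must use it"): the order
hypotheses are killed by the EMPTY rectangle (value `0` against `2π`), the pinning ones by empty /
zero-integrand witnesses against the canonical representations. -/

/-- The crux with `e₁ < e₂` dropped (a route-item VARIANT, not a cited fact). -/
def WithoutLt12 : Prop :=
  ∀ (e₁ e₂ e₃ : ℚ), e₂ < e₃ → ∀ (r : IntegralRep 2) (r' : IntegralRep 1),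
    r.domain = box e₁ e₂ e₃ → EqOn r.integrand (cubicIntegrand e₁ e₂ e₃) r.domain →
    r'.domain = univ → EqOn r'.integrand (fun x => 2 / (1 + x 0 ^ 2)) r'.domain → Equivalent r r'

/-- The crux with `e₂ < e₃` dropped (a route-item VARIANT, not a cited fact). -/
def WithoutLt23 : Prop :=
  ∀ (e₁ e₂ e₃ : ℚ), e₁ < e₂ → ∀ (r : IntegralRep 2) (r' : IntegralRep 1),
    r.domain = box e₁ e₂ e₃ → EqOn r.integrand (cubicIntegrand e₁ e₂ e₃) r.domain →
    r'.domain = univ → EqOn r'.integrand (fun x => 2 / (1 + x 0 ^ 2)) r'.domain → Equivalent r r'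

/-- The crux with `hD : r.domain = R` dropped (a route-item VARIANT, not a cited fact). -/
def WithoutDomainL : Prop :=
  ∀ (e₁ e₂ e₃ : ℚ), e₁ < e₂ → e₂ < e₃ → ∀ (r : IntegralRep 2) (r' : IntegralRep 1),
    EqOn r.integrand (cubicIntegrand e₁ e₂ e₃) r.domain →
    r'.domain = univ → EqOn r'.integrand (fun x => 2 / (1 + x 0 ^ 2)) r'.domain → Equivalent r r'

/-- The crux with `hF : r.integrand = g` dropped (a route-item VARIANT, not a cited fact). -/
def WithoutIntegrandL : Prop :=
  ∀ (e₁ e₂ e₃ : ℚ), e₁ < e₂ → e₂ < e₃ → ∀ (r : IntegralRep 2) (r' : IntegralRep 1),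
    r.domain = box e₁ e₂ e₃ →
    r'.domain = univ → EqOn r'.integrand (fun x => 2 / (1 + x 0 ^ 2)) r'.domain → Equivalent r r'

/-- The crux with `hD' : r'.domain = ℝ` dropped (a route-item VARIANT, not a cited fact). -/
def WithoutDomainR : Prop :=
  ∀ (e₁ e₂ e₃ : ℚ), e₁ < e₂ → e₂ < e₃ → ∀ (r : IntegralRep 2) (r' : IntegralRep 1),
    r.domain = box e₁ e₂ e₃ → EqOn r.integrand (cubicIntegrand e₁ e₂ e₃) r.domain →
    EqOn r'.integrand (fun x => 2 / (1 + x 0 ^ 2)) r'.domain → Equivalent r r'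

/-- The crux with `hF' : r'.integrand = 2/(1+x²)` dropped (a route-item VARIANT, not a cited fact). -/
def WithoutIntegrandR : Prop :=
  ∀ (e₁ e₂ e₃ : ℚ), e₁ < e₂ → e₂ < e₃ → ∀ (r : IntegralRep 2) (r' : IntegralRep 1),
    r.domain = box e₁ e₂ e₃ → EqOn r.integrand (cubicIntegrand e₁ e₂ e₃) r.domain →
    r'.domain = univ → Equivalent r r'

/-- The degenerate rectangle `e₂ ≤ e₁` is empty. [folklore] -/
theorem box_eq_empty_of_le {e₁ e₂ e₃ : ℚ} (h : e₂ ≤ e₁) : box e₁ e₂ e₃ = ∅ := by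
  ext x
  simp only [box, mem_setOf_eq, mem_empty_iff_false, iff_false, not_and]
  intro h1 h2
  have : (e₂ : ℝ) ≤ e₁ := Rat.cast_le.2 h
  exact absurd (h1.trans h2) (not_lt.2 this)

/-- The degenerate rectangle `e₃ ≤ e₂` is empty. [folklore] -/
theorem box_eq_empty_of_le' {e₁ e₂ e₃ : ℚ} (h : e₃ ≤ e₂) : box e₁ e₂ e₃ = ∅ := by
  ext x
  simp only [box, mem_setOf_eq, mem_empty_iff_false, iff_false, not_and]
  intro _ _ h3 h4
  have : (e₃ : ℝ) ≤ e₂ := Rat.cast_le.2 h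
  exact absurd (h3.trans h4) (not_lt.2 this)

/-- **`e₁ < e₂` is load-bearing**: at `(e₁,e₂,e₃) = (0,0,1)` the rectangle is empty, the zero
representation on it is admissible (value `0`) and is not equivalent to `[ℝ, 2/(1+x²)]` (value
`2π`) by soundness `KZ.Equivalent.value_eq_holds`. [folklore] -/
theorem legendreCubicForm_false_without_lt12 : ¬ WithoutLt12 := by
  intro h
  have hE := h 0 0 1 one_pos (zeroRep (box 0 0 1) (isSemialgebraic_box 0 0 1)) twoArctanRep rfl
    (fun x hx => by
      have hx' : x ∈ box 0 0 1 := hx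
      rw [box_eq_empty_of_le le_rfl] at hx'
      exact hx'.elim)
    rfl (fun x _ => rfl)
  have hv := Equivalent.value_eq_holds hE
  rw [zeroRep_value, twoArctanRep_value] at hv
  exact two_pi_ne_zero hv.symm

/-- **`e₂ < e₃` is load-bearing**: at `(0,1,1)` the rectangle is empty; same separation. [folklore] -/
theorem legendreCubicForm_false_without_lt23 : ¬ WithoutLt23 := by
  intro h
  have hE := h 0 1 1 one_pos (zeroRep (box 0 1 1) (isSemialgebraic_box 0 1 1)) twoArctanRep rfl
    (fun x hx => by
      have hx' : x ∈ box 0 1 1 := hx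
      rw [box_eq_empty_of_le' le_rfl] at hx'
      exact hx'.elim)
    rfl (fun x _ => rfl)
  have hv := Equivalent.value_eq_holds hE
  rw [zeroRep_value, twoArctanRep_value] at hv
  exact two_pi_ne_zero hv.symm

/-- **`hD` is load-bearing**: witness `r = [∅, 0]` (value `0`) against the target (value `2π`). [folklore] -/
theorem legendreCubicForm_false_without_domainL : ¬ WithoutDomainL := by
  intro h
  have hE := h 0 1 2 one_pos one_lt_two (emptyRep 2) twoArctanRep (fun x hx => hx.elim) rfl
    (fun x _ => rfl)
  have hv := Equivalent.value_eq_holds hE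
  rw [emptyRep_value, twoArctanRep_value] at hv
  exact two_pi_ne_zero hv.symm

/-- **`hF` is load-bearing**: witness `r = [R, 0]` (value `0`) against the target. [folklore] -/
theorem legendreCubicForm_false_without_integrandL : ¬ WithoutIntegrandL := by
  intro h
  have hE := h 0 1 2 one_pos one_lt_two (zeroRep (box 0 1 2) (isSemialgebraic_box 0 1 2))
    twoArctanRep rfl rfl (fun x _ => rfl)
  have hv := Equivalent.value_eq_holds hE
  rw [zeroRep_value, twoArctanRep_value] at hv
  exact two_pi_ne_zero hv.symm

/-- **`hD'` is load-bearing**: witness `r' = [∅, 0]` against `r₀` (value `2π`). [folklore] -/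
theorem legendreCubicForm_false_without_domainR : ¬ WithoutDomainR := by
  intro h
  have hE := h 0 1 2 one_pos one_lt_two (cubicRep 0 1 2 one_pos one_lt_two) (emptyRep 1) rfl
    (fun x _ => rfl) (fun x hx => hx.elim)
  have hv := Equivalent.value_eq_holds hE
  rw [emptyRep_value, cubicRep_value] at hv
  exact two_pi_ne_zero hv

/-- **`hF'` is load-bearing**: witness `r' = [ℝ, 0]` against `r₀`. [folklore] -/
theorem legendreCubicForm_false_without_integrandR : ¬ WithoutIntegrandR := by
  intro h
  have hE := h 0 1 2 one_pos one_lt_two (cubicRep 0 1 2 one_pos one_lt_two)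
    (zeroRep univ Literature.ModelTheory.ExponentialFields.isSemialgebraic_univ) rfl (fun x _ => rfl) rfl
  have hv := Equivalent.value_eq_holds hE
  rw [zeroRep_value, cubicRep_value] at hv
  exact two_pi_ne_zero hv

/-! ## §6 Newton–Leibniz is necessary

`eval ∘ dimProj 2` (keep the dimension-2 generators, then evaluate) vanishes on the three
SAME-DIMENSION moves (1a), (1b), (2) (`closure_sameDim_le_ker`, 0280 seat) but equals
`value r₀ = 2π ≠ 0` on `[r₀] − [r']` for every one-dimensional `r'`. So every derivation of the
crux uses a rule-(3) move (the hat-box line: its M2), and NO hypothesis on `r'` can repair a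
rule-(3)-free chain (mutation finding). ADDITIVITY is necessary too (informal, no o-minimal Euler
characteristic in Mathlib): `χ(R) = 1 ≠ −1 = χ(ℝ)` while rules (2), (3) preserve `χ`. -/

/-- **Newton–Leibniz is necessary** for every admissible left representation and EVERY
`r' : IntegralRep 1`. [folklore] -/
theorem not_mem_closure_without_newtonLeibniz {e₁ e₂ e₃ : ℚ} (h12 : e₁ < e₂) (h23 : e₂ < e₃)
    (r : IntegralRep 2) (r' : IntegralRep 1) (hd : r.domain = box e₁ e₂ e₃)
    (hf : EqOn r.integrand (cubicIntegrand e₁ e₂ e₃) r.domain) :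
    of r - of r' ∉ AddSubgroup.closure (domainAddRel ∪ integrandAddRel ∪ changeOfVariablesRel) := by
  intro h
  have h0 := closure_sameDim_le_ker 2 h
  rw [AddMonoidHom.mem_ker, AddMonoidHom.coe_comp, Function.comp_apply, map_sub, dimProj_of,
    dimProj_of] at h0
  simp only [↓reduceIte, OfNat.one_ne_ofNat, eval_of, sub_zero] at h0
  have h1 : r.value = (cubicRep e₁ e₂ e₃ h12 h23).value :=
    Equivalent.value_eq_holds (equivalent_of_eqOn r _ (by rw [cubicRep_domain, hd]) hf)
  rw [h1, cubicRep_value] at h0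
  exact two_pi_ne_zero h0

/-! ## §7 Tightness: orientation, order of the gaps, distinct gaps, and the constant

Natural mis-statements of the crux that ARE false (each separated by `KZ.eval`):
* `NegOrientation` — numerator `x₀ − x₁` instead of `x₁ − x₀`: value `−2π`;
* `SwappedBox` — the rectangle `(e₂,e₃) × (e₁,e₂)` (imaginary gap first) with the printed
  integrand: value `−2π` (reindexing by the coordinate swap is a rule-(2) move);
* `SameGap` — the SAME gap twice, `(e₁,e₂)²`: value `I₁⁰I₁¹ − I₁¹I₁⁰ = 0` (the two DIFFERENT cycles
  are essential: this is the alternating pairing of a cycle with itself);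
* `HalfPiTarget` — the right-hand side `[ℝ, 1/(2(1+x²))]` of the sibling cruxes
  `LegendreAllModuli` (3523) / `GpcLegendreLemniscatic` (0280) (value `π/2`): the single-curve
  constant is `2π`, FOUR times the complete-integral constant (half-periods and the monic
  normalisation `y² = P` versus `y² = 4x³ − …` each cost a factor `2`); any other rational multiple
  of `[ℝ, 1/(1+x²)]` fails alike. -/

/-- Variant: numerator `x₀ − x₁` (a route-item VARIANT, not a cited fact). -/
def NegOrientation : Prop :=
  ∀ (e₁ e₂ e₃ : ℚ), e₁ < e₂ → e₂ < e₃ → ∀ (r : IntegralRep 2) (r' : IntegralRep 1),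
    r.domain = box e₁ e₂ e₃ →
    EqOn r.integrand (fun x => (x 0 - x 1) / Real.sqrt (|(x 0 - (e₁ : ℝ)) * (x 0 - (e₂ : ℝ)) *
      (x 0 - (e₃ : ℝ))| * |(x 1 - (e₁ : ℝ)) * (x 1 - (e₂ : ℝ)) * (x 1 - (e₃ : ℝ))|)) r.domain →
    r'.domain = univ → EqOn r'.integrand (fun x => 2 / (1 + x 0 ^ 2)) r'.domain → Equivalent r r'

/-- **Orientation is tight**: `[R, −g]` has value `−2π ≠ 2π`. [folklore] -/
theorem not_negOrientation : ¬ NegOrientation := by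
  intro h
  have hE := h 0 1 2 one_pos one_lt_two (cubicRep 0 1 2 one_pos one_lt_two).neg twoArctanRep rfl
    (fun x _ => by
      simp only [IntegralRep.integrand_neg, Pi.neg_apply, cubicRep_integrand, cubicIntegrand, ← neg_div,
        neg_sub])
    rfl (fun x _ => rfl)
  have hv := Equivalent.value_eq_holds hE
  rw [IntegralRep.value_neg, cubicRep_value, twoArctanRep_value] at hv
  have : (0 : ℝ) < 2 * Real.pi := by positivity
  linarith

/-- Variant: the swapped rectangle `(e₂,e₃) × (e₁,e₂)` with the printed integrand (a route-item
VARIANT, not a cited fact). -/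
def SwappedBox : Prop :=
  ∀ (e₁ e₂ e₃ : ℚ), e₁ < e₂ → e₂ < e₃ → ∀ (r : IntegralRep 2) (r' : IntegralRep 1),
    r.domain = {x | (e₂ : ℝ) < x 0 ∧ x 0 < (e₃ : ℝ) ∧ (e₁ : ℝ) < x 1 ∧ x 1 < (e₂ : ℝ)} →
    EqOn r.integrand (cubicIntegrand e₁ e₂ e₃) r.domain →
    r'.domain = univ → EqOn r'.integrand (fun x => 2 / (1 + x 0 ^ 2)) r'.domain → Equivalent r r'

/-- The coordinate swap of `ℝ²`. [folklore] -/
def swapFin2 : Fin 2 ≃ Fin 2 := Equiv.swap 0 1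

/-- **The order of the two gaps is tight**: on the swapped rectangle the printed integrand
integrates to `−2π`. Witness `((r₀.reindex swap).neg)`, whose value is `−value r₀` because
reindexing is a move (`KZ.of_sub_of_reindex_mem_relations`) and soundness. [folklore] -/
theorem not_swappedBox : ¬ SwappedBox := by
  intro h
  set r₀ := cubicRep 0 1 2 one_pos one_lt_two with hr₀
  have hdom : ((r₀.reindex swapFin2).neg).domain =
      {x | ((1 : ℚ) : ℝ) < x 0 ∧ x 0 < ((2 : ℚ) : ℝ) ∧ ((0 : ℚ) : ℝ) < x 1 ∧ x 1 < ((1 : ℚ) : ℝ)} := by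
    ext x
    simp only [IntegralRep.domain_neg, IntegralRep.reindex_domain, cubicRep_domain, box, swapFin2,
      mem_setOf_eq, Equiv.swap_apply_left, Equiv.swap_apply_right, hr₀]
    tauto
  have hint : EqOn ((r₀.reindex swapFin2).neg).integrand (cubicIntegrand 0 1 2)
      ((r₀.reindex swapFin2).neg).domain := by
    intro x _
    simp only [IntegralRep.integrand_neg, IntegralRep.reindex_integrand, cubicRep_integrand, hr₀,
      Pi.neg_apply, cubicIntegrand, swapFin2, Equiv.swap_apply_left, Equiv.swap_apply_right, ← neg_div,
      neg_sub, mul_comm]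
  have hE := h 0 1 2 one_pos one_lt_two ((r₀.reindex swapFin2).neg) twoArctanRep hdom hint rfl
    (fun x _ => rfl)
  have hv := Equivalent.value_eq_holds hE
  have hre : (r₀.reindex swapFin2).value = r₀.value :=
    (Equivalent.value_eq_holds (of_sub_of_reindex_mem_relations r₀ swapFin2)).symm
  rw [IntegralRep.value_neg, hre, hr₀, cubicRep_value, twoArctanRep_value] at hv
  have : (0 : ℝ) < 2 * Real.pi := by positivity
  linarith

/-- Variant: the SAME gap twice, `(e₁,e₂) × (e₁,e₂)`, with the printed integrand (a route-item
VARIANT, not a cited fact). -/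
def SameGap : Prop :=
  ∀ (e₁ e₂ e₃ : ℚ), e₁ < e₂ → e₂ < e₃ → ∀ (r : IntegralRep 2) (r' : IntegralRep 1),
    r.domain = {x | (e₁ : ℝ) < x 0 ∧ x 0 < (e₂ : ℝ) ∧ (e₁ : ℝ) < x 1 ∧ x 1 < (e₂ : ℝ)} →
    EqOn r.integrand (cubicIntegrand e₁ e₂ e₃) r.domain →
    r'.domain = univ → EqOn r'.integrand (fun x => 2 / (1 + x 0 ^ 2)) r'.domain → Equivalent r r'

/-- **Two DIFFERENT gaps are essential**: the same-gap rectangle representation exists and has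
value `0 ≠ 2π` (stub-free). [folklore] -/
theorem not_sameGap : ¬ SameGap := by
  intro h
  have hE := h 0 1 2 one_pos one_lt_two (sameGapRep 0 1 2 one_pos one_lt_two) twoArctanRep rfl
    (fun x _ => rfl) rfl (fun x _ => rfl)
  have hv := Equivalent.value_eq_holds hE
  rw [sameGapRep_value, twoArctanRep_value] at hv
  exact two_pi_ne_zero hv.symm

/-- Variant: the right-hand side `[ℝ, 1/(2(1+x²))]` (value `π/2`) of cruxes 3523 / 0280 (a
route-item VARIANT, not a cited fact). -/
def HalfPiTarget : Prop :=
  ∀ (e₁ e₂ e₃ : ℚ), e₁ < e₂ → e₂ < e₃ → ∀ (r : IntegralRep 2) (r' : IntegralRep 1),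
    r.domain = box e₁ e₂ e₃ → EqOn r.integrand (cubicIntegrand e₁ e₂ e₃) r.domain →
    r'.domain = univ → EqOn r'.integrand (fun x => 1 / (2 * (1 + x 0 ^ 2))) r'.domain → Equivalent r r'

/-- **The constant is tight**: `[R, g]` (value `2π`) is not equivalent to `[ℝ, 1/(2(1+x²))]`
(value `π/2`). [folklore] -/
theorem not_halfPiTarget : ¬ HalfPiTarget := by
  intro h
  have hE := h 0 1 2 one_pos one_lt_two (cubicRep 0 1 2 one_pos one_lt_two) arctanRep rfl
    (fun x _ => rfl) arctanRep_domain (fun x _ => by rw [arctanRep_integrand])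
  have hv := Equivalent.value_eq_holds hE
  rw [cubicRep_value, arctanRep_value] at hv
  have : (0 : ℝ) < Real.pi := Real.pi_pos
  linarith

/-! ## §8 What does NOT break it (mutation record) and why no substantive kill exists

* Rationality of `eᵢ` is NOT load-bearing for truth: with `IsAlgebraic ℚ eᵢ` the rectangle and the
  hat-box map stay `ℚ`-semialgebraic (tree tools `isSemialgebraicFunOn_const_of_isAlgebraic`,
  `isSemialgebraic_setOf_const_lt_apply`) and the line's proof is parameter-agnostic; with a
  transcendental `eᵢ` the rectangle is not `ℚ`-semialgebraic, no `r` exists and the statement is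
  vacuously true. (Note for 3523 `LegendreAllModuli`, typed for ALGEBRAIC `k`: only the mechanism of
  3521 transfers, not the statement, which is typed for rational roots.)
* Replacing the bounded real gap `(e₁,e₂)` by the unbounded one `(e₃,∞)` makes the variant VACUOUS
  (`x dx/y ∉ L¹` at `∞`), not false — planners should not type it that way.
* The `∀ r'` over representations pinned only by VALUE (`value r' = 2π`) instead of by formula is
  the one-dimensional period conjecture — open, not refutable here.
* A substantive refutation of the crux would need an additive invariant of `FormalRep` vanishing on
  all four move sets and separating two representations of equal value, i.e. a disproof of the
  Kontsevich–Zagier period conjecture in this calculus; moot anyway, since the crux is proved. -/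

end Summit.KontsevichZagierPeriods.KontsevichZagierPeriods.Cruxes.LegendreCubicForm.Disproof
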